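import Summits.MatrixMultiplication.OmegaCensus.CyclicCosetOnsetLaw
import Summits.MatrixMultiplication.OmegaCensus.STPPFiberLift

/-!
# ω-census, C8 (cyclic coset-onset law): both onset sets are non-empty for every `k`; the law as an EQUATION of onsets

HONEST FRAMING (pub-omega census; verbatim): lottery ticket; floor = certified bounds/negative ranges.  Bookkeeping companion of
`CyclicCosetOnsetLaw.lean` (census conjecture C8, typed 2026-08-25, p402398); nothing here is progress on `ω`, and C8 itself stays a
`def … : Prop`, neither proved nor asserted.

WHAT IS PROVED.
* `CosetOnset.hasCosetPow_two_mul` — **the coset lift**: if `ℤ/n` (`n ≥ 1`) hosts `(2,2,2)^k`, then `ℤ/2n` hosts a COSET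
  `(2,2,2)^k` family.  Construction: shrink the first set of every triple to one element `aᵢ` (sub-sets of an STPP family are STPP,
  `isSTPP_mono`), replace it by the full fibre `{σ aᵢ, σ aᵢ + n}` of the reduction `π : ℤ/2n → ℤ/n` — a coset of the subgroup
  `{0, n}` of order two — and lift the other two sets along a section `σ` of `π`; `isSTPP_of_image` (`STPPFiberLift.lean`, the
  census's fibre-lift law NR147) returns an STPP family of `ℤ/2n`.  (The index-2 lift `exists_isSTPP_222pow_zmod_two_mul` of that
  file is the same mechanism for singleton-MIXED families; here the singleton always sits in position `A`, and the coset
  structure of the output is recorded, which the `∃`-statement there forgets.)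
* `CosetOnset.evenHosts_nonempty`, `CosetOnset.evenCosetHosts_nonempty` — for EVERY `k` some even `m > 0` hosts a coset
  `(2,2,2)^k` family (from `exists_isSTPP_222pow_of_card_ge`: `ℤ/T`, `T = (416k²+416)^k`, hosts `(2,2,2)^k`, hence `ℤ/2T` hosts a
  coset family).  So both onsets `sInf (evenHosts k)` and `sInf (evenCosetHosts k)` are attained minima
  (`isLeast_sInf_evenHosts`, `isLeast_sInf_evenCosetHosts`) and C8 is not vacuous and not trivially false at any `k`.
* `cyclicCosetOnsetLaw_iff_sInf_eq` — **C8 is literally the equation of onsets** `sInf (evenHosts k) = sInf (evenCosetHosts k)`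
  for all `k ≥ 2` (the sentence registered in STRUCTURE.md §2: "the least even `m` such that `ℤ/m` hosts a `(2,2,2)^k` family
  EQUALS the least even `m` such that `ℤ/m` hosts a coset family"); the inequality `≤` is unconditional
  (`sInf_evenHosts_le_sInf_evenCosetHosts`), and `sInf (evenCosetHosts k) ≤ 2n` for every host `ℤ/n`
  (`sInf_evenCosetHosts_le_two_mul`: the coset onset is at most twice the unrestricted CYCLIC onset).
* `sInf_evenHosts_two` — the `k = 2` row as numbers: both onsets equal `24` (from `CyclicCosetOnsetLaw.lean`).

ERRATUM to the module docstring of `CyclicCosetOnsetLaw.lean` (l.21–22, prose only, recorded on the cell STATUS 2026-08-25T16:29Z):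
the coset-RESTRICTED complete cells of the census (OMEGA-TABLE N16 / Pb58) are seat pub-omega-stpp-3's (`t4inv --inv 5`, `mixlift`
v4), not ENG1's; ENG1's `c4x 0.3` ran the UNRESTRICTED complete cells (NR145 / P-030).  No declaration depends on that sentence.

References: H. Cohn, R. Kleinberg, B. Szegedy, C. Umans, *Group-theoretic algorithms for matrix multiplication*, FOCS 2005
(arXiv:math/0511460), Def. 5.1.  Seat pub-omega-eng1 (gen 21), 2026-08-25.
-/

open Literature.Computability.AlgebraicComplexity Finset

namespace Summit.MatrixMultiplication.OmegaCensus

namespace CosetOnset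

/-- **The coset lift.**  If `ℤ/n` (`n ≥ 1`) hosts `k` simultaneous-TPP triples of `2`-subsets, then `ℤ/2n` hosts such a family in
which every triple contains a coset `{x, x + n}` of the subgroup of order two (in position `A`): shrink `Aᵢ` to a point `aᵢ`, take
its full fibre under `ℤ/2n → ℤ/n`, lift `Bᵢ, Cᵢ` along a section (`isSTPP_of_image`, NR147).
[cite: CohnKleinbergSzegedyUmans2005, Def. 5.1] -/
theorem hasCosetPow_two_mul {n k : ℕ} [NeZero n] (h : N5Kit.HasPow (ZMod n) k) : HasCosetPow (2 * n) k := by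
  classical
  have hn0 : 0 < n := Nat.pos_of_ne_zero (NeZero.ne n)
  haveI : NeZero (2 * n) := ⟨by omega⟩
  have hdvd : n ∣ 2 * n := Dvd.intro_left 2 rfl
  set π : ZMod (2 * n) →+ ZMod n := (ZMod.castHom hdvd (ZMod n)).toAddMonoidHom with hπdef
  have hπ : Function.Surjective π := ZMod.castHom_surjective hdvd
  set σ : ZMod n → ZMod (2 * n) := Function.surjInv hπ with hσdef
  have hσ : ∀ q, π (σ q) = q := Function.surjInv_eq hπ
  obtain ⟨A, B, C, hS, hc⟩ := h
  have hAne : ∀ i, (A i).Nonempty := fun i => card_pos.1 (by rw [(hc i).1]; norm_num)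
  choose a ha using hAne
  -- the element `n` of order two in `ℤ/2n` and its image
  have hnn : ((n : ℕ) : ZMod (2 * n)) ≠ 0 := by
    rw [Ne, ZMod.natCast_eq_zero_iff]
    intro hd
    have := Nat.le_of_dvd hn0 hd
    omega
  have hπn : π (n : ZMod (2 * n)) = 0 := by
    simp [hπdef]
  -- every fibre of `π` is a coset `{σ q, σ q + n}`
  have hfib_card : ∀ q : ZMod n, (univ.filter fun g => π g = q).card = 2 := by
    intro q
    have h := card_fiber_mul_card π hπ q
    rw [ZMod.card, ZMod.card] at h
    exact Nat.eq_of_mul_eq_mul_right hn0 h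
  have hfib_eq : ∀ q : ZMod n, (univ.filter fun g => π g = q) = {σ q, σ q + (n : ZMod (2 * n))} := by
    intro q
    have hne : σ q ≠ σ q + (n : ZMod (2 * n)) := fun h => hnn (by linear_combination -h)
    symm
    apply eq_of_subset_of_card_le
    · intro g hg
      rw [mem_fiber_iff']
      rcases mem_insert.1 hg with rfl | hg
      · exact hσ q
      · rw [mem_singleton.1 hg, map_add, hσ, hπn, add_zero]
    · rw [hfib_card, card_pair hne]
  refine ⟨fun i => univ.filter fun g => π g = a i, fun i => (B i).image σ, fun i => (C i).image σ, ?_, ?_, ?_⟩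
  · apply isSTPP_of_image π
    · have hA : (fun i => (univ.filter fun g => π g = a i).image π) = fun i => {a i} :=
        funext fun i => image_fiber π hπ _
      have hB : (fun i => ((B i).image σ).image π) = B := funext fun i => image_image_section π hσ _
      have hC : (fun i => ((C i).image σ).image π) = C := funext fun i => image_image_section π hσ _
      rw [hA, hB, hC]
      exact isSTPP_mono hS (fun i => singleton_subset_iff.2 (ha i)) (fun _ => Subset.rfl) fun _ => Subset.rfl
    · exact fun i => Or.inl ⟨injOn_image_section π hσ _, injOn_image_section π hσ _⟩
  · intro i
    exact ⟨hfib_card _, by rw [card_image_section π hσ, (hc i).2.1], by rw [card_image_section π hσ, (hc i).2.2]⟩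
  · intro i
    refine Or.inl ⟨σ (a i), by beta_reduce; rw [mem_fiber_iff', hσ], ?_⟩
    beta_reduce
    rw [hfib_eq, Nat.mul_div_cancel_left n (by norm_num : 0 < 2)]

/-- A host `ℤ/n` (`n ≥ 1`) of `(2,2,2)^k` puts `2n` into `evenCosetHosts k`. -/
theorem two_mul_mem_evenCosetHosts {n k : ℕ} [NeZero n] (h : N5Kit.HasPow (ZMod n) k) : 2 * n ∈ evenCosetHosts k :=
  ⟨by have := NeZero.ne n; omega, ⟨n, two_mul n⟩, hasCosetPow_two_mul h⟩

/-- **For every `k` some even cyclic group hosts a COSET `(2,2,2)^k` family** (`ℤ/2T`, `T = (416k² + 416)^k`, via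
`exists_isSTPP_222pow_of_card_ge` and the coset lift). [cite: CohnKleinbergSzegedyUmans2005, Def. 5.1] -/
theorem evenCosetHosts_nonempty (k : ℕ) : (evenCosetHosts k).Nonempty := by
  haveI : NeZero ((416 * k ^ 2 + 416) ^ k) := ⟨(pow_pos (by positivity) k).ne'⟩
  have h : N5Kit.HasPow (ZMod ((416 * k ^ 2 + 416) ^ k)) k :=
    exists_isSTPP_222pow_of_card_ge k (G := ZMod ((416 * k ^ 2 + 416) ^ k)) (by rw [Nat.card_zmod])
  exact ⟨_, two_mul_mem_evenCosetHosts h⟩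

/-- For every `k` some even cyclic group hosts `(2,2,2)^k`. [cite: CohnKleinbergSzegedyUmans2005, Def. 5.1] -/
theorem evenHosts_nonempty (k : ℕ) : (evenHosts k).Nonempty :=
  (evenCosetHosts_nonempty k).mono (evenCosetHosts_subset k)

/-- The unrestricted even onset `sInf (evenHosts k)` is attained. -/
theorem isLeast_sInf_evenHosts (k : ℕ) : IsLeast (evenHosts k) (sInf (evenHosts k)) :=
  ⟨Nat.sInf_mem (evenHosts_nonempty k), fun _ hm => Nat.sInf_le hm⟩

/-- The coset onset `sInf (evenCosetHosts k)` is attained. -/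
theorem isLeast_sInf_evenCosetHosts (k : ℕ) : IsLeast (evenCosetHosts k) (sInf (evenCosetHosts k)) :=
  ⟨Nat.sInf_mem (evenCosetHosts_nonempty k), fun _ hm => Nat.sInf_le hm⟩

/-- The trivial half of C8: unrestricted even onset `≤` coset onset. -/
theorem sInf_evenHosts_le_sInf_evenCosetHosts (k : ℕ) : sInf (evenHosts k) ≤ sInf (evenCosetHosts k) :=
  Nat.sInf_le (evenCosetHosts_subset k (Nat.sInf_mem (evenCosetHosts_nonempty k)))

/-- The coset onset is at most twice any cyclic host: `(2,2,2)^k ⊆ ℤ/n` (`n ≥ 1`) gives `sInf (evenCosetHosts k) ≤ 2n`. -/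
theorem sInf_evenCosetHosts_le_two_mul {n k : ℕ} [NeZero n] (h : N5Kit.HasPow (ZMod n) k) :
    sInf (evenCosetHosts k) ≤ 2 * n :=
  Nat.sInf_le (two_mul_mem_evenCosetHosts h)

/-- The `k = 2` row as numbers (KERNEL): both onsets are `24`. -/
theorem sInf_evenHosts_two : sInf (evenHosts 2) = 24 ∧ sInf (evenCosetHosts 2) = 24 :=
  ⟨isLeast_evenHosts_two.1.csInf_eq, isLeast_evenHosts_two.2.csInf_eq⟩

end CosetOnset

open CosetOnset

/-- **C8 as the equation of onsets.**  `CyclicCosetOnsetLaw` holds iff for every `k ≥ 2` the least even `m > 0` with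
`(2,2,2)^k ⊆ ℤ/m` equals the least even `m > 0` with a coset `(2,2,2)^k` family in `ℤ/m` — both minima exist by
`evenHosts_nonempty` / `evenCosetHosts_nonempty`.  (The registered sentence of STRUCTURE.md §2 C8, verbatim up to notation.) -/
theorem cyclicCosetOnsetLaw_iff_sInf_eq :
    CyclicCosetOnsetLaw ↔ ∀ k, 2 ≤ k → sInf (evenHosts k) = sInf (evenCosetHosts k) := by
  constructor
  · intro h k hk
    exact (h k hk _ (isLeast_sInf_evenHosts k)).unique (isLeast_sInf_evenCosetHosts k)
  · intro h k hk m hm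
    rw [hm.unique (isLeast_sInf_evenHosts k), h k hk]
    exact isLeast_sInf_evenCosetHosts k

end Summit.MatrixMultiplication.OmegaCensus
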